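import Summits.CriticalPhenomena.CardyFormulaZ2.Theorems.CardyBoundaryCoulombGasHalfPlaneMarkDensityLawRigidity
import Summits.CriticalPhenomena.CardyFormulaZ2.Theses.CardyPerronTeleport
import Summits.CriticalPhenomena.CardyFormulaZ2.Theses.CardyUniqueLimit

/-!
# Line `Sketch` — corollaries of rigidity: the logical position of crux 5 among the CardyFormulaZ2 routes
# (crux `HalfPlaneMarkDensityLaw`, stmt-CriticalPhenomena-5661, route CardyBoundaryCoulombGas)

From `eqOn_cardyFunction_of_collinearCardy` (file `…Rigidity`: the collinear half-plane Cardy law C⁺,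
`⟺` crux 5, pins every universal conformal crossing limit of bond-`ℤ²` to Cardy's `F` on `(0,1)`):

* `cardyRigidity_of_halfPlaneMarkDensityLaw : HalfPlaneMarkDensityLaw → CardyUniqueLimit.CardyRigidity` —
  crux 5 IMPLIES the shared identification crux `CardyRigidity` (stmt-CriticalPhenomena-0746; rank-2 crux
  of route CardyUniqueLimit, shared by CardyCapacityWard, CardyOrderDuality, CardyQContinuation,
  CardyStressTensorWard, CardyTensorRG, CardyWhiteToColoured, DyadicBetaRigidity, PivotalEnergyLaw — the
  nine copies are the same term); so does the conjunct (`cardyRigidity_of_cardyFormulaZ2`, necessity).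
  No SLE₆ identification is needed for `CardyRigidity` once ANY half-plane Cardy statement is available.
* `cardyFormulaZ2_iff_halfPlaneMarkDensityLaw_and_uniqueConformalLimit :
  CardyFormulaZ2 ↔ HalfPlaneMarkDensityLaw ∧ UniqueConformalLimit` — crux 5 is exactly the VALUE half of
  Cardy's formula on `ℤ²`; existence-and-conformal-invariance of the crossing limit
  (`UniqueConformalLimit` = `CardyUniqueLimitThesis`, stmt-CriticalPhenomena-0745, value unspecified) is
  the other half.
-/

noncomputable section

namespace Summit.CriticalPhenomena.CardyFormulaZ2.Cruxes.HalfPlaneMarkDensityLaw.SketchLine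

open Set MeasureTheory Filter
open Literature.Probability.LatticeModels
open Literature.Probability.Percolation hiding cardyFunction
open Literature.Probability.RandomPlanarGeometry
open Summit.CriticalPhenomena.CardyFormulaZ2.Theorems.HalfPlaneMarkDensityLaw.Negative
open Summit.CriticalPhenomena.CardyFormulaZ2.Theses.CardyBoundaryCoulombGas (HalfPlaneMarkDensityLaw)
open Summit.CriticalPhenomena.CardyFormulaZ2.Theses.CardyPerronTeleport (UniqueConformalLimit)
open Summit.CriticalPhenomena.CardyFormulaZ2.Theses.CardyUniqueLimit (CardyRigidity CardyUniqueLimitThesis)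
open scoped Topology

/-- **C⁺ ⟹ `CardyRigidity`** (stmt-CriticalPhenomena-0746): the collinear half-plane Cardy law makes the
shared identification crux of nine CardyFormulaZ2 routes a theorem. [folklore] -/
theorem cardyRigidity_of_collinearCardy
    (hC : ∀ a b c y : ℝ, a < b → b < c → c < y →
      Tendsto (fun n : ℕ ↦ μ.real (openCrossing halfPlane (arcA a b n) (rowIcc ⌊c * n⌋ ⌊y * n⌋))) atTop
        (𝓝 (Literature.Probability.RandomPlanarGeometry.cardyFunction
          (Literature.Probability.RandomPlanarGeometry.crossRatio ![a, b, c, y])))) :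
    CardyRigidity :=
  eqOn_cardyFunction_of_collinearCardy hC

/-- **Crux 5 ⟹ `CardyRigidity`**: `HalfPlaneMarkDensityLaw → CardyUniqueLimit.CardyRigidity`
(stmt-5661 ⟹ stmt-0746). [folklore] -/
theorem cardyRigidity_of_halfPlaneMarkDensityLaw :
    Summit.CriticalPhenomena.CardyFormulaZ2.Theses.CardyBoundaryCoulombGas.HalfPlaneMarkDensityLaw →
      Summit.CriticalPhenomena.CardyFormulaZ2.Theses.CardyUniqueLimit.CardyRigidity :=
  fun h ↦ cardyRigidity_of_collinearCardy (stub_converse h)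

/-- **`CardyRigidity` is necessary for the conjunct**: `CardyFormulaZ2 → CardyRigidity`. [folklore] -/
theorem cardyRigidity_of_cardyFormulaZ2 :
    _root_.CardyFormulaZ2 → Summit.CriticalPhenomena.CardyFormulaZ2.Theses.CardyUniqueLimit.CardyRigidity :=
  fun h ↦ cardyRigidity_of_collinearCardy (collinearCardy_of_cardyFormulaZ2 h)

/-- **C⁺ and a unique conformal limit give the conjunct**: `C⁺ → UniqueConformalLimit → CardyFormulaZ2`.
[folklore] -/
theorem cardyFormulaZ2_of_collinearCardy_of_uniqueConformalLimit
    (hC : ∀ a b c y : ℝ, a < b → b < c → c < y →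
      Tendsto (fun n : ℕ ↦ μ.real (openCrossing halfPlane (arcA a b n) (rowIcc ⌊c * n⌋ ⌊y * n⌋))) atTop
        (𝓝 (Literature.Probability.RandomPlanarGeometry.cardyFunction
          (Literature.Probability.RandomPlanarGeometry.crossRatio ![a, b, c, y]))))
    (hU : UniqueConformalLimit) : _root_.CardyFormulaZ2 := by
  obtain ⟨f, hf⟩ := hU
  intro R φ x hφ
  rw [← eqOn_cardyFunction_of_collinearCardy hC f hf
    (ConformalRectangle.crossRatio_mem_Ioo_of_isUniformizing hφ)]
  exact hf R φ x hφ

/-- **Crux 5 and a unique conformal limit give the conjunct**: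
`HalfPlaneMarkDensityLaw → UniqueConformalLimit → CardyFormulaZ2`. [folklore] -/
theorem cardyFormulaZ2_of_halfPlaneMarkDensityLaw_of_uniqueConformalLimit :
    Summit.CriticalPhenomena.CardyFormulaZ2.Theses.CardyBoundaryCoulombGas.HalfPlaneMarkDensityLaw →
      Summit.CriticalPhenomena.CardyFormulaZ2.Theses.CardyPerronTeleport.UniqueConformalLimit → _root_.CardyFormulaZ2 :=
  fun h hU ↦ cardyFormulaZ2_of_collinearCardy_of_uniqueConformalLimit (stub_converse h) hU

/-- The conjunct gives a unique conformal limit (with `f = F`). [folklore] -/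
theorem uniqueConformalLimit_of_cardyFormulaZ2 : _root_.CardyFormulaZ2 → UniqueConformalLimit :=
  fun h ↦ ⟨_, h⟩

/-- **The logical position of crux 5, sharpened**:
`CardyFormulaZ2 ↔ HalfPlaneMarkDensityLaw ∧ UniqueConformalLimit` — the half-plane mark density law is
exactly the VALUE half of Cardy's formula on `ℤ²`; existence and conformal invariance of the limit
(stmt-CriticalPhenomena-0745) is the other half. [folklore] -/
theorem cardyFormulaZ2_iff_halfPlaneMarkDensityLaw_and_uniqueConformalLimit :
    _root_.CardyFormulaZ2 ↔ Summit.CriticalPhenomena.CardyFormulaZ2.Theses.CardyBoundaryCoulombGas.HalfPlaneMarkDensityLaw ∧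
      Summit.CriticalPhenomena.CardyFormulaZ2.Theses.CardyPerronTeleport.UniqueConformalLimit :=
  ⟨fun h ↦ ⟨halfPlaneMarkDensityLaw_of_cardyFormulaZ2 h, uniqueConformalLimit_of_cardyFormulaZ2 h⟩,
    fun h ↦ cardyFormulaZ2_of_halfPlaneMarkDensityLaw_of_uniqueConformalLimit h.1 h.2⟩


/-- The same with the name `CardyUniqueLimitThesis` of route CardyUniqueLimit for X_U:
`CardyFormulaZ2 ↔ HalfPlaneMarkDensityLaw ∧ CardyUniqueLimitThesis`. [folklore] -/
theorem cardyFormulaZ2_iff_halfPlaneMarkDensityLaw_and_cardyUniqueLimitThesis :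
    _root_.CardyFormulaZ2 ↔ HalfPlaneMarkDensityLaw ∧ CardyUniqueLimitThesis :=
  cardyFormulaZ2_iff_halfPlaneMarkDensityLaw_and_uniqueConformalLimit

end Summit.CriticalPhenomena.CardyFormulaZ2.Cruxes.HalfPlaneMarkDensityLaw.SketchLine

end
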